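import Summits.KontsevichZagierPeriods.KontsevichZagierPeriods.Theorems.SoloBlindCells
import Summits.KontsevichZagierPeriods.KontsevichZagierPeriods.Theorems.SoloBlindPeeling
import Literature.NumberTheory.Transcendental.KZGroundingRelations
import Mathlib.Analysis.SpecialFunctions.Trigonometric.Arctan
import HarnessLib

/-!
# The Kontsevich–Zagier conjecture in dimension `≤ 1`, IIb: integer and rational relations among cells

The peeling induction (`sum_zsmul_mem_of_peel`) specialised to the standard cells:
* `Σ_i n_i log λ_i = 0` (`n_i ∈ ℤ`, `λ_i > 1` algebraic) ⟹ `Σ_i n_i • L(b; λ_i) ∈ KZ.relations`;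
* `Σ_i n_i arctan τ_i = 0` (`n_i ∈ ℤ`, `τ_i > 0` algebraic) ⟹ `Σ_i n_i • A(b; τ_i) ∈ KZ.relations`;
for every fixed real-algebraic coefficient `b`, and the same with RATIONAL coefficients moved
into the cells: `Σ_i N_i log λ_i = 0` (`N_i ∈ ℚ`) ⟹ `Σ_i L(b N_i; λ_i) ∈ KZ.relations` (clear
denominators, then integer scaling of the integrand is multiplication in the formal group), and
likewise for arctangent cells.  The admissible lengths are `t = log λ` (`eᵗ` algebraic) resp.
`θ = arctan τ ∈ (0, π/2)` (`tan θ` algebraic); differences of admissible lengths are admissible by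
`e^{s−t} = eˢ/eᵗ` resp. the subtraction formula for `tan`, and the peeling elements are the
peeling moves `logCell_peel`, `atanCell_peel` of part I.
-/

noncomputable section

open MeasureTheory Set Filter Finset
open scoped BigOperators Topology

namespace Summit.KontsevichZagierPeriods.KontsevichZagierPeriods.Theorems

open Literature.NumberTheory.Transcendental
open Literature.NumberTheory.Transcendental.KZ

namespace SoloBlind

universe u

attribute [local instance] Classical.propDecidable

/-! ## Logarithmic cells -/

section log

variable (b : ℝ) (hb : IsAlgebraic ℚ b)

/-- The family of standard logarithmic cells `t ↦ [L(b; eᵗ)]` indexed by the length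
`t = log λ` (zero where `eᵗ` is not algebraic). -/
def logFam (t : ℝ) : FormalRep :=
  if h : IsAlgebraic ℚ (Real.exp t) then of (logCell b (Real.exp t) hb h) else 0

/-- `logFam` at an admissible length. -/
theorem logFam_of {t : ℝ} (h : IsAlgebraic ℚ (Real.exp t)) :
    logFam b hb t = of (logCell b (Real.exp t) hb h) :=
  dif_pos h

/-- `logFam (log λ) = [L(b; λ)]`. -/
theorem logFam_log {l : ℝ} (hl0 : 0 < l) (hl : IsAlgebraic ℚ l) :
    logFam b hb (Real.log l) = of (logCell b l hb hl) := by
  have h : IsAlgebraic ℚ (Real.exp (Real.log l)) := by rw [Real.exp_log hl0]; exact hl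
  rw [logFam_of b hb h]
  exact congrArg of (logCell_congr rfl (Real.exp_log hl0))

/-- Admissible logarithmic lengths are closed under differences. -/
theorem isAlgebraic_exp_sub {t s : ℝ} (ht : IsAlgebraic ℚ (Real.exp t))
    (hs : IsAlgebraic ℚ (Real.exp s)) : IsAlgebraic ℚ (Real.exp (s - t)) := by
  rw [Real.exp_sub]
  exact hs.mul ht.inv

/-- The peeling move for the logarithmic family. -/
theorem logFam_peel ⦃t s : ℝ⦄ (ht : IsAlgebraic ℚ (Real.exp t)) (hs : IsAlgebraic ℚ (Real.exp s))
    (h0 : 0 < t) (hts : t < s) :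
    logFam b hb s - logFam b hb t - logFam b hb (s - t) ∈ relations := by
  have hst := isAlgebraic_exp_sub ht hs
  rw [logFam_of b hb hs, logFam_of b hb ht, logFam_of b hb hst]
  have h1 : 1 ≤ Real.exp t := by
    have := Real.add_one_le_exp t
    linarith
  have h2 : Real.exp t ≤ Real.exp s := Real.exp_le_exp.mpr hts.le
  have hml : IsAlgebraic ℚ (Real.exp s / Real.exp t) := by rw [← Real.exp_sub]; exact hst
  have h := logCell_peel (c := b) (l := Real.exp t) (hc := hb) (hl := ht) (m := Real.exp s)
    (hm := hs) h1 h2 (hml := hml)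
  have he : logCell b (Real.exp (s - t)) hb hst = logCell b (Real.exp s / Real.exp t) hb hml :=
    logCell_congr rfl (Real.exp_sub s t)
  rw [he]
  exact h

/-- **Integer relations among logarithms are realised by moves.** If `Σ_i n_i log λ_i = 0` with
`n_i ∈ ℤ` and `λ_i > 1` real algebraic, then `Σ_i n_i • [L(b; λ_i)] ∈ KZ.relations` for every
real-algebraic coefficient `b`. -/
theorem sum_zsmul_logCell_mem_relations {ι : Type u} [Fintype ι] (n : ι → ℤ) (l : ι → ℝ)
    (hla : ∀ i, IsAlgebraic ℚ (l i)) (h1 : ∀ i, 1 < l i)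
    (hrel : ∑ i, (n i : ℝ) * Real.log (l i) = 0) :
    ∑ i, n i • of (logCell b (l i) hb (hla i)) ∈ relations := by
  have h0 : ∀ i, 0 < l i := fun i => one_pos.trans (h1 i)
  have h := sum_zsmul_mem_of_peel relations (fun t => IsAlgebraic ℚ (Real.exp t)) (logFam b hb)
    (fun t s ht hs _ => isAlgebraic_exp_sub ht hs) (logFam_peel b hb) n
    (fun i => Real.log (l i)) (fun i => Real.log_pos (h1 i))
    (fun i => by rw [Real.exp_log (h0 i)]; exact hla i) hrel
  have he : ∀ i, logFam b hb (Real.log (l i)) = of (logCell b (l i) hb (hla i)) :=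
    fun i => logFam_log b hb (h0 i) (hla i)
  simp only [he] at h
  exact h

/-- Clearing denominators: a finite family of rationals times the product of its denominators
is a family of integers. -/
theorem exists_int_eq_rat_mul_prod_den {ι : Type u} [Fintype ι] (N : ι → ℚ) :
    ∃ (D : ℕ) (m : ι → ℤ), 0 < D ∧ ∀ i, (m i : ℚ) = N i * D := by
  refine ⟨∏ i, (N i).den, fun i => (N i).num * ((∏ j, (N j).den) / (N i).den : ℕ),
    Finset.prod_pos fun i _ => (N i).den_pos, fun i => ?_⟩
  obtain ⟨K, hK⟩ : (N i).den ∣ ∏ j, (N j).den := Finset.dvd_prod_of_mem _ (Finset.mem_univ i)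
  dsimp only
  rw [hK, Nat.mul_div_cancel_left _ (N i).den_pos]
  push_cast
  rw [← Rat.mul_den_eq_num (N i)]
  ring

include hb in
/-- **Rational relations among logarithms are realised by moves.** If `Σ_i N_i log λ_i = 0` with
`N_i ∈ ℚ` and `λ_i > 1` real algebraic, then `Σ_i [L(b N_i; λ_i)] ∈ KZ.relations`. -/
theorem sum_logCell_ratCoeff_mem_relations {ι : Type u} [Fintype ι] (N : ι → ℚ) (l : ι → ℝ)
    (hla : ∀ i, IsAlgebraic ℚ (l i)) (h1 : ∀ i, 1 < l i)
    (hrel : ∑ i, (N i : ℝ) * Real.log (l i) = 0) {hc : ∀ i, IsAlgebraic ℚ (b * N i)} :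
    ∑ i, of (logCell (b * N i) (l i) (hc i) (hla i)) ∈ relations := by
  obtain ⟨D, m, hD, hm⟩ := exists_int_eq_rat_mul_prod_den N
  have hD' : (D : ℝ) ≠ 0 := by exact_mod_cast hD.ne'
  have hbD : IsAlgebraic ℚ (b / D) := hb.mul (isAlgebraic_nat D).inv
  have hm' : ∀ i, (m i : ℝ) = (N i : ℝ) * D := fun i => by exact_mod_cast hm i
  -- `L(b N_i; λ_i) ≡ m_i • L(b/D; λ_i)`
  have hcoef : ∀ i, b * N i = m i * (b / D) := fun i => by rw [hm' i]; field_simp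
  have hz : ∀ i, of (logCell (b * N i) (l i) (hc i) (hla i)) -
      m i • of (logCell (b / D) (l i) hbD (hla i)) ∈ relations := by
    intro i
    have hmc : IsAlgebraic ℚ (m i * (b / D)) := by rw [← hcoef i]; exact hc i
    rw [logCell_congr (hc := hc i) (hl := hla i) (hcoef i) rfl (hc' := hmc) (hl' := hla i)]
    exact logSeg_coeff_zsmul (m i)
  have hint : ∑ i, m i • of (logCell (b / D) (l i) hbD (hla i)) ∈ relations := by
    refine sum_zsmul_logCell_mem_relations (b / D) hbD m l hla h1 ?_
    simp_rw [hm', mul_assoc, mul_comm (D : ℝ), ← mul_assoc, ← Finset.sum_mul, hrel, zero_mul]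
  have hdiff := sum_sub_sum_mem_relations univ _ _ fun i _ => hz i
  have := relations.add_mem hdiff hint
  simpa using this

/-- Coefficient additivity over a finite sum: `L(Σ_j e_j; λ) ≡ Σ_j L(e_j; λ)`. -/
theorem logCell_coeff_sum {κ : Type u} (s : Finset κ) (e : κ → ℝ) (he : ∀ j, IsAlgebraic ℚ (e j))
    {l : ℝ} (hl : IsAlgebraic ℚ l) {hs : IsAlgebraic ℚ (∑ j ∈ s, e j)} :
    of (logCell (∑ j ∈ s, e j) l hs hl) - ∑ j ∈ s, of (logCell (e j) l (he j) hl) ∈ relations :=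
  of_sub_sum_integrand_mem_relations s (fun j => logCell (e j) l (he j) hl) _ (fun _ _ => rfl)
    fun x _ => by simp [logCell_eq, Finset.sum_div]

end log

/-! ## Arctangent cells -/

section atan

variable (b : ℝ) (hb : IsAlgebraic ℚ b)

/-- Admissible angles: `θ ∈ (0, π/2)` with `tan θ` algebraic. -/
def AtanGood (θ : ℝ) : Prop := 0 < θ ∧ θ < Real.pi / 2 ∧ IsAlgebraic ℚ (Real.tan θ)

/-- The family of standard arctangent cells `θ ↦ [A(b; tan θ)]` indexed by the angle (zero at
inadmissible angles). -/
def atanFam (θ : ℝ) : FormalRep :=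
  if h : AtanGood θ then of (atanCell b (Real.tan θ) hb h.2.2) else 0

/-- `atanFam` at an admissible angle. -/
theorem atanFam_of {θ : ℝ} (h : AtanGood θ) :
    atanFam b hb θ = of (atanCell b (Real.tan θ) hb h.2.2) :=
  dif_pos h

/-- `arctan τ` is admissible for `τ > 0` algebraic. -/
theorem atanGood_arctan {τ : ℝ} (h0 : 0 < τ) (hτ : IsAlgebraic ℚ τ) : AtanGood (Real.arctan τ) :=
  ⟨Real.arctan_pos.2 h0, Real.arctan_lt_pi_div_two τ, by rw [Real.tan_arctan]; exact hτ⟩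

/-- `atanFam (arctan τ) = [A(b; τ)]`. -/
theorem atanFam_arctan {τ : ℝ} (h0 : 0 < τ) (hτ : IsAlgebraic ℚ τ) :
    atanFam b hb (Real.arctan τ) = of (atanCell b τ hb hτ) := by
  rw [atanFam_of b hb (atanGood_arctan h0 hτ)]
  exact congrArg of (atanCell_congr rfl (Real.tan_arctan τ))

/-- The subtraction formula for `tan` on `(0, π/2)`:
`tan (s − t) = (tan s − tan t)/(1 + tan t · tan s)`. -/
theorem tan_sub_eq {t s : ℝ} (ht0 : 0 < t) (ht : t < Real.pi / 2) (hs0 : 0 < s)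
    (hs : s < Real.pi / 2) :
    Real.tan (s - t) = (Real.tan s - Real.tan t) / (1 + Real.tan t * Real.tan s) := by
  have hτ0 : 0 < Real.tan t := Real.tan_pos_of_pos_of_lt_pi_div_two ht0 ht
  have hρ0 : 0 < Real.tan s := Real.tan_pos_of_pos_of_lt_pi_div_two hs0 hs
  have hat : Real.arctan (Real.tan t) = t :=
    Real.arctan_tan (by linarith [Real.pi_pos]) ht
  have has : Real.arctan (Real.tan s) = s :=
    Real.arctan_tan (by linarith [Real.pi_pos]) hs
  have hadd : Real.arctan (Real.tan s) + Real.arctan (-Real.tan t) =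
      Real.arctan ((Real.tan s + -Real.tan t) / (1 - Real.tan s * -Real.tan t)) :=
    Real.arctan_add (by nlinarith)
  have e : (Real.tan s + -Real.tan t) / (1 - Real.tan s * -Real.tan t) =
      (Real.tan s - Real.tan t) / (1 + Real.tan t * Real.tan s) := by
    congr 1
    ring
  have hst : s - t =
      Real.arctan ((Real.tan s - Real.tan t) / (1 + Real.tan t * Real.tan s)) := by
    rw [← e, ← hadd, Real.arctan_neg, hat, has]
    ring
  rw [hst, Real.tan_arctan]

/-- Admissible angles are closed under differences. -/
theorem atanGood_sub ⦃t s : ℝ⦄ (ht : AtanGood t) (hs : AtanGood s) (hts : t < s) :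
    AtanGood (s - t) := by
  refine ⟨sub_pos.mpr hts, by linarith [ht.1, hs.2.1], ?_⟩
  rw [tan_sub_eq ht.1 ht.2.1 hs.1 hs.2.1]
  exact (hs.2.2.sub ht.2.2).mul (isAlgebraic_one.add (ht.2.2.mul hs.2.2)).inv

/-- The peeling move for the arctangent family. -/
theorem atanFam_peel ⦃t s : ℝ⦄ (ht : AtanGood t) (hs : AtanGood s) (_h0 : 0 < t) (hts : t < s) :
    atanFam b hb s - atanFam b hb t - atanFam b hb (s - t) ∈ relations := by
  have hst := atanGood_sub ht hs hts
  rw [atanFam_of b hb hs, atanFam_of b hb ht, atanFam_of b hb hst]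
  have hτ0 : 0 ≤ Real.tan t := (Real.tan_pos_of_pos_of_lt_pi_div_two ht.1 ht.2.1).le
  have hτρ : Real.tan t ≤ Real.tan s :=
    (Real.strictMonoOn_tan ⟨by linarith [ht.1, Real.pi_pos], ht.2.1⟩
      ⟨by linarith [hs.1, Real.pi_pos], hs.2.1⟩ hts).le
  exact atanCell_peel (hd := hb) (hτ := ht.2.2) (hρ := hs.2.2) hτ0 hτρ
    (tan_sub_eq ht.1 ht.2.1 hs.1 hs.2.1) (hρ'a := hst.2.2)

/-- **Integer relations among arctangents are realised by moves.** If `Σ_i n_i arctan τ_i = 0`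
with `n_i ∈ ℤ` and `τ_i > 0` real algebraic, then `Σ_i n_i • [A(b; τ_i)] ∈ KZ.relations` for
every real-algebraic coefficient `b`. -/
theorem sum_zsmul_atanCell_mem_relations {ι : Type u} [Fintype ι] (n : ι → ℤ) (τ : ι → ℝ)
    (hτa : ∀ i, IsAlgebraic ℚ (τ i)) (h0 : ∀ i, 0 < τ i)
    (hrel : ∑ i, (n i : ℝ) * Real.arctan (τ i) = 0) :
    ∑ i, n i • of (atanCell b (τ i) hb (hτa i)) ∈ relations := by
  have h := sum_zsmul_mem_of_peel relations AtanGood (atanFam b hb) atanGood_sub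
    (atanFam_peel b hb) n (fun i => Real.arctan (τ i)) (fun i => Real.arctan_pos.2 (h0 i))
    (fun i => atanGood_arctan (h0 i) (hτa i)) hrel
  have he : ∀ i, atanFam b hb (Real.arctan (τ i)) = of (atanCell b (τ i) hb (hτa i)) :=
    fun i => atanFam_arctan b hb (h0 i) (hτa i)
  simp only [he] at h
  exact h

include hb in
/-- **Rational relations among arctangents are realised by moves.** If
`Σ_i N_i arctan τ_i = 0` with `N_i ∈ ℚ` and `τ_i > 0` real algebraic, then
`Σ_i [A(b N_i; τ_i)] ∈ KZ.relations`. -/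
theorem sum_atanCell_ratCoeff_mem_relations {ι : Type u} [Fintype ι] (N : ι → ℚ) (τ : ι → ℝ)
    (hτa : ∀ i, IsAlgebraic ℚ (τ i)) (h0 : ∀ i, 0 < τ i)
    (hrel : ∑ i, (N i : ℝ) * Real.arctan (τ i) = 0) {hc : ∀ i, IsAlgebraic ℚ (b * N i)} :
    ∑ i, of (atanCell (b * N i) (τ i) (hc i) (hτa i)) ∈ relations := by
  obtain ⟨D, m, hD, hm⟩ := exists_int_eq_rat_mul_prod_den N
  have hD' : (D : ℝ) ≠ 0 := by exact_mod_cast hD.ne'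
  have hbD : IsAlgebraic ℚ (b / D) := hb.mul (isAlgebraic_nat D).inv
  have hm' : ∀ i, (m i : ℝ) = (N i : ℝ) * D := fun i => by exact_mod_cast hm i
  have hcoef : ∀ i, b * N i = m i * (b / D) := fun i => by rw [hm' i]; field_simp
  have hz : ∀ i, of (atanCell (b * N i) (τ i) (hc i) (hτa i)) -
      m i • of (atanCell (b / D) (τ i) hbD (hτa i)) ∈ relations := by
    intro i
    have hmc : IsAlgebraic ℚ (m i * (b / D)) := by rw [← hcoef i]; exact hc i
    rw [atanCell_congr (hd := hc i) (hτ := hτa i) (hcoef i) rfl (hd' := hmc) (hτ' := hτa i)]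
    exact atanSeg_coeff_zsmul (m i)
  have hint : ∑ i, m i • of (atanCell (b / D) (τ i) hbD (hτa i)) ∈ relations := by
    refine sum_zsmul_atanCell_mem_relations (b / D) hbD m τ hτa h0 ?_
    simp_rw [hm', mul_assoc, mul_comm (D : ℝ), ← mul_assoc, ← Finset.sum_mul, hrel, zero_mul]
  have hdiff := sum_sub_sum_mem_relations univ _ _ fun i _ => hz i
  have := relations.add_mem hdiff hint
  simpa using this

/-- Coefficient additivity over a finite sum: `A(Σ_j e_j; τ) ≡ Σ_j A(e_j; τ)`. -/
theorem atanCell_coeff_sum {κ : Type u} (s : Finset κ) (e : κ → ℝ) (he : ∀ j, IsAlgebraic ℚ (e j))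
    {τ : ℝ} (hτ : IsAlgebraic ℚ τ) {hs : IsAlgebraic ℚ (∑ j ∈ s, e j)} :
    of (atanCell (∑ j ∈ s, e j) τ hs hτ) - ∑ j ∈ s, of (atanCell (e j) τ (he j) hτ) ∈ relations :=
  of_sub_sum_integrand_mem_relations s (fun j => atanCell (e j) τ (he j) hτ) _ (fun _ _ => rfl)
    fun x _ => by simp [atanCell_eq, Finset.sum_div]

end atan

end SoloBlind

end Summit.KontsevichZagierPeriods.KontsevichZagierPeriods.Theorems
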